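import Literature.IUT.HodgeArakelov.GaloisPairCyclotomesThetaSyncOfBase
import Literature.IUT.HodgeTheaters.ZHatEndomorphisms
import HarnessLib

/-!
# Bridge B12, `Π`-side at Cor. 1.10's GENUINE family — the (E)+(C) residual is a pair of CHARACTER IDENTITIES
# (proof-only: `End(Ẑ)` is commutative, hence the residual isomorphism of [IUTchII] Cor. 1.11 (b) is immaterial)

Mochizuki, *Inter-universal Teichmüller theory II*, §1, Corollary 1.11 (b), kurims manuscript (Dec. 2020) p. 49
ll. 22–35: "the `Aut(G)`-orbit of isomorphisms `μ_Ẑ(G) ⥲ (l·Δ_Θ)(Π)` obtained … from the natural isomorphism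
`μ_Ẑ(G_k) ⥲ μ_Ẑ(Π_X)` of [AbsTopIII], Corollary 1.10, (c)", and Remark 1.11.1 (i)(b) p. 50 "the natural action of
`Ẑ^×` [on `μ_Ẑ(G)`]" [claim: Mochizuki2012, status: disputed] (IUTchII §1 Cor 1.11, kurims p.49); [EtTh] §1 p. 12
(PRIMS p. 238) "`Δ_Θ (≅ Ẑ(1))`" [cite: MochizukiEtTh2009, §1 p.12]; [AbsTopIII] Cor. 1.10 (c) p. 42 "the natural
isomorphism `μ_Ẑ(G_k) ⥲ μ_Ẑ(Π_X)`" [cite: MochizukiAbsTopIII2015, Cor 1.10 (ii) p.42]. Record-only typing under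
the claim key `Mochizuki2012` (D-0012, disputed); abc-iut cell, layer L6, node `IUTchII:Cor1.11` (B12 `Π`-side) over
node `IUTchII:Cor1.10` (lineage abc-iut-w5-d145 / abc-iut-w4-d038), sequel of abc-iut-w4-d024's
`GaloisPairCyclotomesThetaSyncOfBase` (p424707).

STATE BEFORE THIS FILE. p424707 reduces the `Π`-side input `GalCorPiXInput A X.family` of Cor. 1.11 over Cor. 1.10's
base-datum family (in particular abc-iut-w4-d038's GENUINE `EtaleLevels.familyLim`) to ONE existential sentence at
`Π₀`: `∃ c : μ_Ẑ(Π₀/Δ₀) ⥲ (l·Δ_Θ)(Π₀)` which is (E) `Π₀`-equivariant and (C) compatible with the `Aut(Π₀)`-action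
`ρ_A` (`GalCorPiXInput.nonempty_family_iff`, `EtaleLevels.nonempty_galCorPiXInput_familyLim_iff`).

THIS FILE (proof-only; no definition, no named `Prop` fact, nothing of another seat edited or restated) removes the
existential over ISOMORPHISMS from that residual:

* (companion file `IUT/HodgeTheaters/ZHatEndomorphisms.lean`, `Literature.IUT.HodgeTheaters.ZHat.*`) CLASSICAL RIGIDITY
  OF `Ẑ = profiniteCompletion ℤ` AS AN ABSTRACT GROUP:
  `Ker(Ẑ → ℤ/N)` consists of `[ℤ:N]`-th powers (`exists_pow_index_eq_of_val_eq_one`, i.e. `Ẑ/NẐ = ℤ/NẐ`); hence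
  EVERY group endomorphism of `Ẑ` acts on each finite level as multiplication by an integer (`monoidHom_val_eq`),
  `End(Ẑ)` is commutative (`monoidHom_comp_comm`), and so is the endomorphism monoid of any group `≃* Ẑ`
  (`monoidHom_apply_comm_of_mulEquiv`, `mulEquiv_apply_comm_of_mulEquiv`). (This is the content behind "the natural
  action of `Ẑ^×`" on a cyclotome: `Aut(Ẑ) = Ẑ^×` is abelian.)
* `GalCorPiXInput.equivariant_transfer` / `compatible_transfer` — for a base datum `X` with `X.A ≃* Ẑ` (the genuine
  case: `hZ`, G-w4d021-1, PROVED by abc-iut-L2-d1 p415192 modulo G-w4d021-2), conditions (E) and (C) of p424707 DO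
  NOT DEPEND on the isomorphism `c`: if one `c` satisfies (E) (resp. (C)) then every `c'` does (conjugate by
  `c⁻¹ ≫ c' ∈ Aut((l·Δ_Θ)(Π₀))`, which commutes with `actA x` / `ρ_A(γ)`).
* `GalCorPiXInput.nonempty_family_iff_forall`, `…_iff_of_iso` — hence the residual is EXACTLY: "`μ_Ẑ(Π₀/Δ₀)` and
  `(l·Δ_Θ)(Π₀)` are abstractly isomorphic, AND for any one (equivalently every) identification, the cyclotomic action
  of `Π₀/Δ₀` on `μ_Ẑ` matches the conjugation action of `Π₀` on `(l·Δ_Θ)` [(E) = [EtTh] §1 p. 12 "`Δ_Θ ≅ Ẑ(1)`" AS A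
  GALOIS MODULE — the L2 root interface `Setting.lean` v3 lists this among its «Deferred TRANSCRIPTIONS»] and the
  `Aut(Π₀)`-transport of `μ_Ẑ` matches `ρ_A` [(C) = [AbsTopIII] Cor. 1.10 (c) naturality, FACT-LIST F-0348 owner
  side, composed with [EtTh] Cor. 2.19 (i)]" — two CHARACTER IDENTITIES (equalities of scalars in the commutative
  group `Aut(Ẑ)`), testable on any single identification; no choice of isomorphism is part of the datum.
* `IsoClass.nonempty_galCyclotome_mulEquiv_iff` — the abstract-isomorphism conjunct depends only on the reference
  group: `μ_Ẑ(G) ≃* T` is inhabited for an isomorph `G` of `G_k` iff `μ_Ẑ(G_k) ≃* T` is (transport `μ_Ẑ(e)`).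
* `EtaleLevels.*` — the same sentences AT THE GENUINE NATURAL SYSTEM (`familyLim`, `baseDatumLim`; the hypothesis
  `X.A ≃* Ẑ` is the family's own binder `hZ` at level `1`): `nonempty_galCorPiXInput_familyLim_iff_forall`,
  `…_iff_of_iso`, and the first conjunct reduced to `Nonempty (μ_Ẑ(G_K) ≃* Ẑ)` for the genuine Galois group
  `G_K` of the [EtTh] setting (`nonempty_galCyclotome_basePointLim_iff`) — [AbsTopIII] Cor. 1.10 (i)(a) /
  [AbsAnab] Prop. 1.2.1 (vi)(vii), which abc-iut-L4's `exists_muZhat_mulEquiv_cyclotome_units` PROVES for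
  `Gal(k̄/k) = Field.absoluteGaloisGroup k` of every non-archimedean local field of characteristic `0` (the junction
  `G_K ≅ Gal(k̄/k)` for `K ⊆ ℚ̄_p` + `Λ(k̄ˣ) ≅ Ẑ` is L4/L2 interface work, named here, not done here).

HONEST FRAMING: classical profinite-group algebra plus bookkeeping over typed interfaces; the two character identities
are NOT proved here (they are the print-level sentences named above, owner side L2 root interface / FACT-LIST F-0348);
nothing here bears on [IUTchIII] Cor. 3.12 and no side is taken; typed ≠ discharged.
-/

noncomputable section

/-! ## Part B. The (E)+(C) residual of [IUTchII] Cor. 1.11 (b) at a base-datum family does not depend on the iso -/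

namespace Literature.IUT.HodgeArakelov

open CategoryTheory
open Literature.AnabelianGeometry.AbsoluteAnabelian
open Literature.IUT.HodgeTheaters (ZHat)

universe u

namespace IsoClass

variable {P : TopGroup.{u}} [CompactSpace P]

/-- The ABSTRACT-ISOMORPHISM conjunct depends only on the reference group: for an isomorph `G` of the compact group
`P`, `μ_Ẑ(G) ≃* T` is inhabited iff `μ_Ẑ(P) ≃* T` is (transport along `μ_Ẑ(e)`, `e : G ⥲ P` the comparison of the
connected groupoid `IsoClass P`). [claim: Mochizuki2012, status: disputed] (IUTchII §1 Cor 1.11, kurims p.49) -/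
theorem nonempty_galCyclotome_mulEquiv_iff (X : IsoClass P) (T : Type*) [Mul T] :
    Nonempty (↥X.galCyclotome ≃* T) ↔ Nonempty (↥(IsoClass.base P).galCyclotome ≃* T) := by
  obtain ⟨e⟩ := IsoClass.nonempty_hom X (IsoClass.base P)
  exact ⟨fun ⟨c⟩ => ⟨(galCyclotomeMap e).symm.trans c⟩, fun ⟨c⟩ => ⟨(galCyclotomeMap e).trans c⟩⟩

end IsoClass

variable {S : ThetaSetting.{u}}

namespace GalCorPiXInput

variable [CompactSpace S.Gk] (A : AbsTopMonoids S) {P₀ : IsoClass S.PiX} (X : MonoThetaBaseDatum S P₀)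

/-- **(E) does not depend on the isomorphism.** If `(l·Δ_Θ)(Π₀) ≃* Ẑ` (abstractly) and ONE isomorphism
`c : μ_Ẑ(Π₀/Δ₀) ⥲ (l·Δ_Θ)(Π₀)` is `Π₀`-equivariant, then EVERY isomorphism `c'` is: `c' = (c⁻¹ ≫ c') ∘ c` and the
automorphism `c⁻¹ ≫ c'` of `(l·Δ_Θ)(Π₀) ≅ Ẑ` commutes with `actA x` (`End(Ẑ)` is commutative). So (E) is a property
of the pair of ACTIONS — "`Δ_Θ ≅ Ẑ(1)` as a Galois module" ([EtTh] §1 p. 12) — not of `c`.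
[claim: Mochizuki2012, status: disputed] (IUTchII §1 Cor 1.11, kurims p.49) -/
theorem equivariant_transfer (hA : Nonempty (↥X.A ≃* ZHat)) (c c' : ↥(A.quotObj P₀).galCyclotome ≃* X.A)
    (hE : ∀ (x : P₀.G) (ζ : (A.quotObj P₀).galCyclotome),
      c (haveI := (A.quotObj P₀).compactSpace_carrier; (QuotientGroup.mk x : P₀.G ⧸ A.Delta P₀) • ζ) =
        X.actA x (c ζ))
    (x : P₀.G) (ζ : (A.quotObj P₀).galCyclotome) :
    c' (haveI := (A.quotObj P₀).compactSpace_carrier; (QuotientGroup.mk x : P₀.G ⧸ A.Delta P₀) • ζ) =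
      X.actA x (c' ζ) := by
  obtain ⟨e⟩ := hA
  have hδ : ∀ ξ, c' ξ = (c.symm.trans c') (c ξ) := fun ξ => by
    rw [MulEquiv.trans_apply, MulEquiv.symm_apply_apply]
  rw [hδ, hE, hδ ζ]
  exact Literature.IUT.HodgeTheaters.ZHat.mulEquiv_apply_comm_of_mulEquiv e (c.symm.trans c') (X.actA x) (c ζ)

/-- **(C) does not depend on the isomorphism.** If `(l·Δ_Θ)(Π₀) ≃* Ẑ` and ONE isomorphism
`c : μ_Ẑ(Π₀/Δ₀) ⥲ (l·Δ_Θ)(Π₀)` intertwines `μ_Ẑ(quotMap γ)` with `ρ_A(γ)` for every topological automorphism `γ` of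
`Π₀`, then EVERY isomorphism does (same argument with `ρ_A(γ) ∈ Aut((l·Δ_Θ)(Π₀))`). So (C) is a property of the two
`Aut(Π₀)`-ACTIONS — [AbsTopIII] Cor. 1.10 (c) naturality composed with [EtTh] Cor. 2.19 (i) — not of `c`.
[claim: Mochizuki2012, status: disputed] (IUTchII §1 Cor 1.11, kurims p.49) -/
theorem compatible_transfer (hA : Nonempty (↥X.A ≃* ZHat)) (c c' : ↥(A.quotObj P₀).galCyclotome ≃* X.A)
    (hC : ∀ (γ : P₀ ⟶ P₀) (ζ : (A.quotObj P₀).galCyclotome),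
      c (IsoClass.galCyclotomeMap (A.quotMap γ) ζ) = X.rhoA (IsoClass.homIso γ) (c ζ))
    (γ : P₀ ⟶ P₀) (ζ : (A.quotObj P₀).galCyclotome) :
    c' (IsoClass.galCyclotomeMap (A.quotMap γ) ζ) = X.rhoA (IsoClass.homIso γ) (c' ζ) := by
  obtain ⟨e⟩ := hA
  have hδ : ∀ ξ, c' ξ = (c.symm.trans c') (c ξ) := fun ξ => by
    rw [MulEquiv.trans_apply, MulEquiv.symm_apply_apply]
  rw [hδ, hC, hδ ζ]
  exact Literature.IUT.HodgeTheaters.ZHat.mulEquiv_apply_comm_of_mulEquiv e (c.symm.trans c')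
    (X.rhoA (IsoClass.homIso γ)) (c ζ)

/-- **The `Π`-side residual of [IUTchII] Cor. 1.11 (b) at a base-datum family, WITHOUT the existential over
isomorphisms**: when `(l·Δ_Θ)(Π₀) ≃* Ẑ`, `GalCorPiXInput A X.family` is inhabited iff (1) `μ_Ẑ(Π₀/Δ₀)` and
`(l·Δ_Θ)(Π₀)` are abstractly isomorphic and (2) EVERY isomorphism between them is `Π₀`-equivariant and
`Aut(Π₀)`-compatible — i.e. (E) and (C) are identities between the ACTIONS (characters), independent of any choice.
[claim: Mochizuki2012, status: disputed] (IUTchII §1 Cor 1.11, kurims p.49) -/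
theorem nonempty_family_iff_forall (hA : Nonempty (↥X.A ≃* ZHat)) :
    Nonempty (GalCorPiXInput A X.family) ↔
      Nonempty (↥(A.quotObj P₀).galCyclotome ≃* X.A) ∧
      ∀ c : ↥(A.quotObj P₀).galCyclotome ≃* X.A,
        (∀ (x : P₀.G) (ζ : (A.quotObj P₀).galCyclotome),
          c (haveI := (A.quotObj P₀).compactSpace_carrier; (QuotientGroup.mk x : P₀.G ⧸ A.Delta P₀) • ζ) =
            X.actA x (c ζ)) ∧
        ∀ (γ : P₀ ⟶ P₀) (ζ : (A.quotObj P₀).galCyclotome),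
          c (IsoClass.galCyclotomeMap (A.quotMap γ) ζ) = X.rhoA (IsoClass.homIso γ) (c ζ) := by
  rw [nonempty_family_iff]
  constructor
  · rintro ⟨c, hE, hC⟩
    exact ⟨⟨c⟩, fun c' => ⟨equivariant_transfer A X hA c c' hE, compatible_transfer A X hA c c' hC⟩⟩
  · rintro ⟨⟨c⟩, h⟩
    exact ⟨c, h c⟩

/-- **Test on any ONE identification.** When `(l·Δ_Θ)(Π₀) ≃* Ẑ`, for ANY isomorphism
`c₀ : μ_Ẑ(Π₀/Δ₀) ⥲ (l·Δ_Θ)(Π₀)` whatsoever: `GalCorPiXInput A X.family` is inhabited iff `c₀` itself is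
`Π₀`-equivariant and `Aut(Π₀)`-compatible. [claim: Mochizuki2012, status: disputed] (IUTchII §1 Cor 1.11, kurims p.49) -/
theorem nonempty_family_iff_of_iso (hA : Nonempty (↥X.A ≃* ZHat)) (c₀ : ↥(A.quotObj P₀).galCyclotome ≃* X.A) :
    Nonempty (GalCorPiXInput A X.family) ↔
      (∀ (x : P₀.G) (ζ : (A.quotObj P₀).galCyclotome),
          c₀ (haveI := (A.quotObj P₀).compactSpace_carrier; (QuotientGroup.mk x : P₀.G ⧸ A.Delta P₀) • ζ) =
            X.actA x (c₀ ζ)) ∧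
        ∀ (γ : P₀ ⟶ P₀) (ζ : (A.quotObj P₀).galCyclotome),
          c₀ (IsoClass.galCyclotomeMap (A.quotMap γ) ζ) = X.rhoA (IsoClass.homIso γ) (c₀ ζ) := by
  rw [nonempty_family_iff_forall A X hA]
  exact ⟨fun ⟨_, h⟩ => h c₀, fun h => ⟨⟨c₀⟩, fun c =>
    ⟨equivariant_transfer A X hA c₀ c h.1, compatible_transfer A X hA c₀ c h.2⟩⟩⟩

/-- **The residual as two CHARACTER IDENTITIES in `Ẑ` — no isomorphism left in the statement.** Given ANY
identifications `e₁ : μ_Ẑ(Π₀/Δ₀) ⥲ Ẑ`, `e₂ : (l·Δ_Θ)(Π₀) ⥲ Ẑ` (abstract group isomorphisms; the scalars below do not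
depend on them, `ZHat.scalar_indep`), `GalCorPiXInput A X.family` is inhabited iff
(E′) for every `x ∈ Π₀`: the profinite integer by which `x̄ ∈ Π₀/Δ₀` acts on `μ_Ẑ(Π₀/Δ₀)` (the CYCLOTOMIC CHARACTER,
[AbsAnab] Prop. 1.2.1 (vi)) equals the one by which `x` acts on `(l·Δ_Θ)(Π₀)` ([EtTh] §1 p. 12 "`Δ_Θ ≅ Ẑ(1)`"), and
(C′) for every topological automorphism `γ` of `Π₀`: the scalar of `μ_Ẑ(quotMap γ)` equals the scalar of `ρ_A(γ)`
([AbsTopIII] Cor. 1.10 (c) naturality + [EtTh] Cor. 2.19 (i)). [claim: Mochizuki2012, status: disputed]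
(IUTchII §1 Cor 1.11, kurims p.49) -/
theorem nonempty_family_iff_scalar (e₁ : ↥(A.quotObj P₀).galCyclotome ≃* ZHat) (e₂ : ↥X.A ≃* ZHat) :
    Nonempty (GalCorPiXInput A X.family) ↔
      (∀ x : P₀.G,
          e₁ (haveI := (A.quotObj P₀).compactSpace_carrier;
                (QuotientGroup.mk x : P₀.G ⧸ A.Delta P₀) •
                  e₁.symm (Literature.IUT.HodgeTheaters.toCompletion (Multiplicative ℤ) (Multiplicative.ofAdd (1 : ℤ)))) =
            e₂ (X.actA x
              (e₂.symm (Literature.IUT.HodgeTheaters.toCompletion (Multiplicative ℤ) (Multiplicative.ofAdd (1 : ℤ)))))) ∧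
      ∀ γ : P₀ ⟶ P₀,
        e₁ (IsoClass.galCyclotomeMap (A.quotMap γ)
              (e₁.symm (Literature.IUT.HodgeTheaters.toCompletion (Multiplicative ℤ) (Multiplicative.ofAdd (1 : ℤ))))) =
          e₂ (X.rhoA (IsoClass.homIso γ)
              (e₂.symm (Literature.IUT.HodgeTheaters.toCompletion (Multiplicative ℤ) (Multiplicative.ofAdd (1 : ℤ))))) := by
  haveI := (A.quotObj P₀).compactSpace_carrier
  rw [nonempty_family_iff_of_iso A X ⟨e₂⟩ (e₁.trans e₂.symm)]
  refine and_congr (forall_congr' fun x => ?_) (forall_congr' fun γ => ?_)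
  · have h := Literature.IUT.HodgeTheaters.ZHat.semiconj_iff_scalar_eq e₁ e₂
      (MulDistribMulAction.toMonoidHom (↥(A.quotObj P₀).galCyclotome) (QuotientGroup.mk x : P₀.G ⧸ A.Delta P₀))
      (X.actA x).toMonoidHom (e₁.trans e₂.symm)
    simpa only [MulDistribMulAction.toMonoidHom_apply, MulEquiv.coe_toMonoidHom] using h
  · have h := Literature.IUT.HodgeTheaters.ZHat.semiconj_iff_scalar_eq e₁ e₂
      (IsoClass.galCyclotomeMap (A.quotMap γ)).toMonoidHom (X.rhoA (IsoClass.homIso γ)).toMonoidHom (e₁.trans e₂.symm)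
    simpa only [MulEquiv.coe_toMonoidHom] using h

/-- The abstract-isomorphism conjunct at a base datum, read on the reference group `G_k` of the setting:
`μ_Ẑ(Π₀/Δ₀) ≃* (l·Δ_Θ)(Π₀)` is inhabited iff `μ_Ẑ(G_k) ≃* (l·Δ_Θ)(Π₀)` is.
[claim: Mochizuki2012, status: disputed] (IUTchII §1 Cor 1.11, kurims p.49) -/
theorem nonempty_galCyclotome_quotObj_mulEquiv_iff :
    Nonempty (↥(A.quotObj P₀).galCyclotome ≃* X.A) ↔ Nonempty (↥(IsoClass.base S.Gk).galCyclotome ≃* X.A) :=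
  IsoClass.nonempty_galCyclotome_mulEquiv_iff _ _

end GalCorPiXInput

/-! ## Part C. The same at the GENUINE natural system (abc-iut-w4-d038's `familyLim` / `baseDatumLim`) -/

namespace EtaleLevels

open Literature.AnabelianGeometry.EtaleTheta Literature.AnabelianGeometry.SemiGraphs
open scoped Literature.AnabelianGeometry.EtaleTheta

variable {p : ℕ} [Fact p.Prime] {D : Literature.AnabelianGeometry.EtaleTheta.ThetaSetting p}
  {E : D.EtaleThetaData} {l : ℕ} (C : E.DoubleUnderline l) (hC : D.Compat) (hS : D.Sec2Hyps)
  (hl : l.Prime) (hp2 : p ≠ 2) (hpl : p ≠ l) (hζ : ∃ ζ : D.K, IsPrimitiveRoot ζ (4 * l))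
  (mods : ∀ M : ℕ+, D.CyclotomeMod l M)
  (f : contCocycles D.toTheta D.DeltaTheta C.GtpYdduu) (hf : f ∈ C.rootCocycles hC)
  (hmods : ∀ (M M' : ℕ+) (h : (M : ℕ) ∣ (M' : ℕ)) (x : D.lDeltaTheta l),
    MuN.red p M M' h ((mods M').red x) = (mods M).red x)
  (h15 : Literature.AnabelianGeometry.EtaleTheta.ThetaSetting.Prop15iii E hC) (L : C.CuspLabels)
  (hZ : ∀ M : ℕ+, Nonempty (ModelCyclotomes.lDeltaQuot (C.rigidData (mods M) hC hS h15 L) ≃*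
    Literature.IUT.HodgeTheaters.ZHat))
  (h218i₁ : (levelRigid C hC hS mods h15 L 1).Cor218_i)

/-- The interior module `(l·Δ_Θ)(𝕄_*)` of the genuine base datum is abstractly `≃* Ẑ`: this is the family's own
binder `hZ` at level `1` (G-w4d021-1; supplied by abc-iut-L2-d1's `nonempty_lDeltaQuot_rigidData_mulEquiv_zHat` from
`IsEtThOrigin` + `hYcl`). [claim: Mochizuki2012, status: disputed] (IUTchII §1 Cor 1.10, kurims p.47) -/
theorem nonempty_baseDatumLim_A_mulEquiv_zHat :
    Nonempty (↥(baseDatumLim C hC hS hl hp2 hpl hζ mods f hf hmods h15 L hZ h218i₁).A ≃* Literature.IUT.HodgeTheaters.ZHat) := by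
  obtain ⟨e⟩ := hZ 1
  exact ⟨e⟩

/-- **The `Π`-side residual of [IUTchII] Cor. 1.11 (b) AT THE GENUINE NATURAL SYSTEM, without the existential over
isomorphisms**: for any Ex. 1.8 output `A` over the [EtTh]-model setting, `GalCorPiXInput A familyLim` is inhabited iff
(1) `μ_Ẑ(Π^tp_{X̲̲}/Δ) ≃* (l·Δ_Θ)(𝕄_*)` abstractly and (2) EVERY such isomorphism is `Π^tp_{X̲̲}`-equivariant
(cyclotomic character vs conjugation on `l·Δ_Θ`: [EtTh] §1 p. 12 "`Δ_Θ ≅ Ẑ(1)`" as a Galois module) and compatible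
with `rhoALim γ` for every topological automorphism `γ` ([AbsTopIII] Cor. 1.10 (c) + [EtTh] Cor. 2.19 (i)).
[claim: Mochizuki2012, status: disputed] (IUTchII §1 Cor 1.11, kurims p.49) -/
theorem nonempty_galCorPiXInput_familyLim_iff_forall [CompactSpace (setting C hC hS hl hp2 hpl hζ mods f hf).Gk]
    (A : AbsTopMonoids (setting C hC hS hl hp2 hpl hζ mods f hf)) :
    Nonempty (GalCorPiXInput A (familyLim C hC hS hl hp2 hpl hζ mods f hf hmods h15 L hZ h218i₁)) ↔
      Nonempty (↥(A.quotObj (basePointLim C hC hS hl hp2 hpl hζ mods f hf hmods h15 L hZ)).galCyclotome ≃*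
          (baseDatumLim C hC hS hl hp2 hpl hζ mods f hf hmods h15 L hZ h218i₁).A) ∧
      ∀ c : ↥(A.quotObj (basePointLim C hC hS hl hp2 hpl hζ mods f hf hmods h15 L hZ)).galCyclotome ≃*
          (baseDatumLim C hC hS hl hp2 hpl hζ mods f hf hmods h15 L hZ h218i₁).A,
        (∀ (x : (basePointLim C hC hS hl hp2 hpl hζ mods f hf hmods h15 L hZ).G)
            (ζ : (A.quotObj (basePointLim C hC hS hl hp2 hpl hζ mods f hf hmods h15 L hZ)).galCyclotome),
          c (haveI := (A.quotObj (basePointLim C hC hS hl hp2 hpl hζ mods f hf hmods h15 L hZ)).compactSpace_carrier;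
              (QuotientGroup.mk x : _ ⧸ A.Delta _) • ζ) =
            (baseDatumLim C hC hS hl hp2 hpl hζ mods f hf hmods h15 L hZ h218i₁).actA x (c ζ)) ∧
        ∀ (γ : basePointLim C hC hS hl hp2 hpl hζ mods f hf hmods h15 L hZ ⟶
              basePointLim C hC hS hl hp2 hpl hζ mods f hf hmods h15 L hZ)
            (ζ : (A.quotObj (basePointLim C hC hS hl hp2 hpl hζ mods f hf hmods h15 L hZ)).galCyclotome),
          c (IsoClass.galCyclotomeMap (A.quotMap γ) ζ) =
            (baseDatumLim C hC hS hl hp2 hpl hζ mods f hf hmods h15 L hZ h218i₁).rhoA (IsoClass.homIso γ) (c ζ) :=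
  GalCorPiXInput.nonempty_family_iff_forall A _
    (nonempty_baseDatumLim_A_mulEquiv_zHat C hC hS hl hp2 hpl hζ mods f hf hmods h15 L hZ h218i₁)

/-- **At the genuine natural system: the `Π`-side residual of [IUTchII] Cor. 1.11 (b) IS two character identities in
`Ẑ`.** Given any identifications `e₁ : μ_Ẑ(Π^tp_{X̲̲}/Δ) ⥲ Ẑ` (owner side [AbsTopIII] Cor. 1.10 (i)(a) / L4) and
`e₂ : (l·Δ_Θ)(𝕄_*) ⥲ Ẑ` (e.g. `(hZ 1).some`), `GalCorPiXInput A familyLim` is inhabited iff (E′) the cyclotomic character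
of `G_K` on `μ_Ẑ` and the conjugation character of `Π^tp_{X̲̲}` on `(l·Δ_Θ)(𝕄_*)` agree as maps `Π^tp_{X̲̲} → Ẑ` ([EtTh] §1
p. 12 "`Δ_Θ ≅ Ẑ(1)`" AS A GALOIS MODULE) and (C′) for every topological automorphism `γ` of `Π^tp_{X̲̲}`, the scalar of
`μ_Ẑ(quotMap γ)` equals the scalar of `rhoALim γ` ([AbsTopIII] Cor. 1.10 (c) + [EtTh] Cor. 2.19 (i)). These two sentences
are the exact typed residual; neither is proved here. [claim: Mochizuki2012, status: disputed] (IUTchII §1 Cor 1.11, kurims p.49) -/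
theorem nonempty_galCorPiXInput_familyLim_iff_scalar [CompactSpace (setting C hC hS hl hp2 hpl hζ mods f hf).Gk]
    (A : AbsTopMonoids (setting C hC hS hl hp2 hpl hζ mods f hf))
    (e₁ : ↥(A.quotObj (basePointLim C hC hS hl hp2 hpl hζ mods f hf hmods h15 L hZ)).galCyclotome ≃*
      Literature.IUT.HodgeTheaters.ZHat)
    (e₂ : ↥(baseDatumLim C hC hS hl hp2 hpl hζ mods f hf hmods h15 L hZ h218i₁).A ≃* Literature.IUT.HodgeTheaters.ZHat) :
    Nonempty (GalCorPiXInput A (familyLim C hC hS hl hp2 hpl hζ mods f hf hmods h15 L hZ h218i₁)) ↔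
      (∀ x : (basePointLim C hC hS hl hp2 hpl hζ mods f hf hmods h15 L hZ).G,
          e₁ (haveI := (A.quotObj (basePointLim C hC hS hl hp2 hpl hζ mods f hf hmods h15 L hZ)).compactSpace_carrier;
                (QuotientGroup.mk x : _ ⧸ A.Delta _) •
                  e₁.symm (Literature.IUT.HodgeTheaters.toCompletion (Multiplicative ℤ) (Multiplicative.ofAdd (1 : ℤ)))) =
            e₂ ((baseDatumLim C hC hS hl hp2 hpl hζ mods f hf hmods h15 L hZ h218i₁).actA x
              (e₂.symm (Literature.IUT.HodgeTheaters.toCompletion (Multiplicative ℤ) (Multiplicative.ofAdd (1 : ℤ)))))) ∧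
      ∀ γ : basePointLim C hC hS hl hp2 hpl hζ mods f hf hmods h15 L hZ ⟶
            basePointLim C hC hS hl hp2 hpl hζ mods f hf hmods h15 L hZ,
        e₁ (IsoClass.galCyclotomeMap (A.quotMap γ)
              (e₁.symm (Literature.IUT.HodgeTheaters.toCompletion (Multiplicative ℤ) (Multiplicative.ofAdd (1 : ℤ))))) =
          e₂ ((baseDatumLim C hC hS hl hp2 hpl hζ mods f hf hmods h15 L hZ h218i₁).rhoA (IsoClass.homIso γ)
              (e₂.symm (Literature.IUT.HodgeTheaters.toCompletion (Multiplicative ℤ) (Multiplicative.ofAdd (1 : ℤ))))) :=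
  GalCorPiXInput.nonempty_family_iff_scalar A _ e₁ e₂

/-- **The abstract-isomorphism conjunct at the genuine natural system is «`μ_Ẑ(G_K) ≅ Ẑ`» for the GENUINE Galois group
`G_K` of the [EtTh] setting** ([AbsTopIII] Cor. 1.10 (i)(a); [AbsAnab] Prop. 1.2.1 (vi)(vii)): `μ_Ẑ(Π^tp_{X̲̲}/Δ) ≃* (l·Δ_Θ)(𝕄_*)`
is inhabited iff `μ_Ẑ(G_K) ≃* Ẑ` is (both `(l·Δ_Θ)(𝕄_*) ≃* Ẑ` by `hZ` and `Π^tp_{X̲̲}/Δ ≅ G_K`). abc-iut-L4's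
`exists_muZhat_mulEquiv_cyclotome_units` proves `μ_Ẑ(Gal(k̄/k)) ≅ Λ(k̄ˣ)` for `Gal(k̄/k) = Field.absoluteGaloisGroup k`;
the junctions `G_K ≅ Gal(k̄/k)` (for `K ⊆ ℚ̄_p`) and `Λ(k̄ˣ) ≅ Ẑ` are interface work named, not done, here.
[claim: Mochizuki2012, status: disputed] (IUTchII §1 Cor 1.11, kurims p.49) -/
theorem nonempty_galCyclotome_basePointLim_iff [CompactSpace (setting C hC hS hl hp2 hpl hζ mods f hf).Gk]
    (A : AbsTopMonoids (setting C hC hS hl hp2 hpl hζ mods f hf)) :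
    Nonempty (↥(A.quotObj (basePointLim C hC hS hl hp2 hpl hζ mods f hf hmods h15 L hZ)).galCyclotome ≃*
        (baseDatumLim C hC hS hl hp2 hpl hζ mods f hf hmods h15 L hZ h218i₁).A) ↔
      Nonempty (↥(muZhat (setting C hC hS hl hp2 hpl hζ mods f hf).Gk) ≃* Literature.IUT.HodgeTheaters.ZHat) := by
  obtain ⟨e⟩ := nonempty_baseDatumLim_A_mulEquiv_zHat C hC hS hl hp2 hpl hζ mods f hf hmods h15 L hZ h218i₁
  rw [GalCorPiXInput.nonempty_galCyclotome_quotObj_mulEquiv_iff]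
  exact ⟨fun ⟨c⟩ => ⟨c.trans e⟩, fun ⟨c⟩ => ⟨c.trans e.symm⟩⟩

end EtaleLevels

end Literature.IUT.HodgeArakelov

end
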